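import Mathlib
import Literature.NumberTheory.Irrationality.Brown2016.DinnerParties
import Literature.NumberTheory.Irrationality.BrownZudilin2022.VanishingInTheMiddle
import Summits.KontsevichZagierPeriods.Zeta5Search.Families.CellularIntegral
import HarnessLib

/-!
# ζ(5) search — Families: the `M_{0,10}` configuration "vanishing in the middle" as an instance of the general cellular integral

HONEST FRAMING: systematic search; no irrationality claim unless certified.

Cell `pub-zeta5`, seat P2 (entry point for `fam-brown9`, target T2 "one of `ζ(5), ζ(7)`").  ANCHORS tying
`Families/CellularIntegral.lean` to the typed data of `Literature/…/BrownZudilin2022/VanishingInTheMiddle.lean`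
[BrownZudilin2022, §12; Brown2016, App. 2 §10.2.6]:

* `vim10 = (10,2,4,1,6,3,8,5,9,7)` (0-based `![9,1,3,0,5,2,7,4,8,6]`) = `ofSeating [10,2,4,1,6,3,8,5,9,7]`, injective;
* `basic_vim` : `basic vim10 n = BrownZudilin2022.vimIntegrand n` (as functions on `ℝ⁷`), `openSimplex_seven`,
  `integral_vim` : the basic cellular integral `I_σ(n)` is `BrownZudilin2022.vimIntegral n`;
* `brownConvergent_vim_iff` : Brown's chord condition for exponents all `N` holds iff `0 ≤ N` (the 70 valuations are
  `2N` ×32, `4N+2` ×30, `6N+4` ×8; second implementation HOME `code/p2/cellular_forms.py`).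
* GENERAL exponents (the `fam-brown9` family, 11 free exponents on a lattice): `vim10Den a b` — the ten denominator
  exponents in Brown's parameters `a i = a_{i+1,i+2}` and `b = b(7,10)`, solved from the homogeneity equations;
  `homogeneous_vim10_iff` (`↔ a₁ + a₂ = a₈ + a₉`, Brown's lattice `H_σ` (5.5)); `brownConvergent_vim10_iff` — the region of
  convergence on `H_σ` as 16 irredundant linear inequalities (70 chord valuations, 32 distinct mod `H_σ`; exact LP in HOME
  `code/p2/cellular_atlas.py`, equivalence kernel-checked).  The integrand itself is `integrand vim10 a (vim10Den a b)`
  (explicit rational function by the recipe in `Families/CellularIntegral.lean`).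
-/

noncomputable section

open MeasureTheory Finset Set

namespace Summit.KontsevichZagierPeriods.Zeta5Search.Families.Cellular

open Literature.NumberTheory.Irrationality

/-! ### The `M_{0,10}` configuration "vanishing in the middle" `(10,2,4,1,6,3,8,5,9,7)` -/

/-- `(10,2,4,1,6,3,8,5,9,7)` [Brown2016, App. 2 §10.2.6; BrownZudilin2022, §12] as a map `Fin 10 → Fin 10`
(0-based values `(9,1,3,0,5,2,7,4,8,6)`). -/
def vim10 : Fin 10 → Fin 10 := ![9, 1, 3, 0, 5, 2, 7, 4, 8, 6]

/-- `vim10` is the printed seating plan `(10,2,4,1,6,3,8,5,9,7)` read 0-based (cf. `Brown2016.tenVanishingMiddle`). -/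
theorem vim10_eq_ofSeating : vim10 = ofSeating (ℓ := 7) [10, 2, 4, 1, 6, 3, 8, 5, 9, 7] := by decide

/-- `vim10` is injective (a permutation). -/
theorem vim10_injective : Function.Injective vim10 := by decide

/-- ANCHOR: the basic cellular integrand of `(10,2,4,1,6,3,8,5,9,7)` with all exponents `n` IS the integrand of the
integrals `I_n` displayed in [BrownZudilin2022, §12 p. 29] (typed as `BrownZudilin2022.vimIntegrand`), on all of `ℝ⁷`. -/
theorem basic_vim (n : ℕ) (t : Fin 7 → ℝ) : basic vim10 n t = BrownZudilin2022.vimIntegrand n t := by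
  rw [basic_eq, zpow_natCast]
  simp [formDen, Fin.prod_univ_succ, vim10, ef, pt, max_def, min_def, BrownZudilin2022.vimIntegrand,
    BrownZudilin2022.vimNum, BrownZudilin2022.vimDen]
  ring

/-- The simplex of this file for `ℓ = 7` is `BrownZudilin2022.openSimplex7`. -/
theorem openSimplex_seven : openSimplex 7 = BrownZudilin2022.openSimplex7 := by
  ext t
  simp [openSimplex, BrownZudilin2022.openSimplex7, Fin.forall_fin_succ, pt]

/-- ANCHOR: the basic cellular integral `I_σ(n)` of `(10,2,4,1,6,3,8,5,9,7)` is `I_n` of [BrownZudilin2022, §12]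
(`BrownZudilin2022.vimIntegral n`). -/
theorem integral_vim (n : ℕ) :
    integral vim10 (fun _ => (n : ℤ)) (fun _ => (n : ℤ)) = BrownZudilin2022.vimIntegral n := by
  unfold integral BrownZudilin2022.vimIntegral
  rw [openSimplex_seven]
  congr 1
  ext t
  exact basic_vim n t

/-- Brown's convergence condition holds for the basic cellular integrals of `(10,2,4,1,6,3,8,5,9,7)` with exponent
`N ≥ 0` — and only for those: the `10 × 7 = 70` values `twoOrd` (each divisor counted twice) are `2N` (32 times),
`4N + 2` (30 times) and `6N + 4` (8 times), i.e. orders of vanishing `N`, `2N+1`, `3N+2` (second implementation: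
HOME `code/p2/cellular_forms.py`); in particular the configuration is convergent [Brown2016, App. 2 §10.2.6;
BrownZudilin2022, §12]. -/
theorem brownConvergent_vim_iff (N : ℤ) : BrownConvergent vim10 (fun _ => N) (fun _ => N) ↔ 0 ≤ N := by
  unfold BrownConvergent twoOrd
  dsimp only [Nat.reduceAdd]
  simp only [forall_fin10, forall_fin7, sum_fin10]
  simp [sameSide, vim10]
  constructor <;> intro h <;> and_intros <;> omega

/-! ### General exponents for `(10,2,4,1,6,3,8,5,9,7)` (the `10`-parameter generalised family) -/

/-- Denominator exponents of the generalised `(10,2,4,1,6,3,8,5,9,7)` family, by position on `σδ⁰`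
(`b(10,2), b(2,4), b(4,1), b(1,6), b(6,3), b(3,8), b(8,5), b(5,9), b(9,7), b(7,10)`), in the parameters
`a i = a_{i+1,i+2}` (`a : Fin 10 → ℤ`, 0-based; indices mod 10) and the free exponent `b = b(7,10)`, the others
solved from Brown's homogeneity equations [Brown2016, §5.1 (5.2), §5.2]. -/
def vim10Den (a : Fin 10 → ℤ) (b : ℤ) : Fin 10 → ℤ :=
  ![a 8 + a 9 - b, a 0 + a 1 - a 8 - a 9 + b, -a 0 - a 1 + a 2 + a 3 + a 8 + a 9 - b,
    2 * a 0 + a 1 - a 2 - a 3 - a 8 + b, -2 * a 0 - a 1 + a 2 + a 3 + a 4 + a 5 + a 8 - b,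
    2 * a 0 + 2 * a 1 - a 3 - a 4 - a 5 - a 8 + b, -2 * a 0 - 2 * a 1 + a 3 + a 4 + a 5 + a 6 + a 7 + a 8 - b,
    2 * a 0 + 2 * a 1 - a 5 - a 6 - a 7 - a 8 + b, -2 * a 0 - 2 * a 1 + a 5 + a 6 + 2 * a 7 + 2 * a 8 - b, b]

/-- Homogeneity of the generalised `(10,2,4,1,6,3,8,5,9,7)` family holds exactly on Brown's lattice `H_σ` [Brown2016, §5.2 (5.5)]:
`a 7 + a 8 = a 0 + a 1`. -/
theorem homogeneous_vim10_iff (a : Fin 10 → ℤ) (b : ℤ) :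
    Homogeneous vim10 a (vim10Den a b) ↔ a 7 + a 8 = a 0 + a 1 := by
  unfold Homogeneous
  dsimp only [Nat.reduceAdd]
  have e : (-1 : Fin 10) = 9 := by decide
  constructor
  · intro h
    have h' := h 9
    simp [vim10, vim10Den] at h'
    linarith
  · intro h i
    fin_cases i <;> simp [vim10, vim10Den, e] <;> linarith

/-- The region of convergence of the generalised `(10,2,4,1,6,3,8,5,9,7)` family on `H_σ`: Brown's chord condition (all
`10 × 7` valuations; 32 distinct forms modulo `H_σ`, of which the 16 below are irredundant over `ℝ` —
exact LP, HOME `code/p2/cellular_atlas.py`; the equivalence itself is kernel-checked). [Brown2016, §2.4 (2.3), §5.2] -/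
theorem brownConvergent_vim10_iff (a : Fin 10 → ℤ) (b : ℤ) (hH : a 7 + a 8 = a 0 + a 1) :
    BrownConvergent vim10 a (vim10Den a b) ↔
      0 ≤ a 0 ∧
      0 ≤ a 1 ∧
      0 ≤ a 2 ∧
      0 ≤ a 3 ∧
      0 ≤ a 4 ∧
      0 ≤ a 5 ∧
      0 ≤ a 6 ∧
      0 ≤ a 7 ∧
      0 ≤ a 8 ∧
      0 ≤ a 9 ∧
      0 ≤ -a 1 + a 7 + b ∧
      0 ≤ -a 3 + a 7 + a 8 ∧
      0 ≤ -a 3 + a 7 + b ∧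
      0 ≤ -a 5 + a 7 + a 8 ∧
      0 ≤ -a 5 + a 7 + b ∧
      0 ≤ -a 0 + a 2 + a 8 + a 9 - b := by
  unfold BrownConvergent twoOrd
  dsimp only [Nat.reduceAdd]
  simp only [forall_fin10, forall_fin7, sum_fin10]
  simp [sameSide, vim10, vim10Den]
  constructor <;> intro h <;> and_intros <;> omega


end Summit.KontsevichZagierPeriods.Zeta5Search.Families.Cellular
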